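import Mathlib.LinearAlgebra.Charpoly.BaseChange
import Mathlib.LinearAlgebra.TensorProduct.Pi
import Mathlib.LinearAlgebra.TensorProduct.RightExactness
import Mathlib.RepresentationTheory.Coinvariants
import Literature.NumberTheory.GaloisRepresentations.ContinuousRep
import HarnessLib

/-!
# Coinvariants commute with extension of scalars (characteristic polynomials)

Let `k → E` be a homomorphism of fields, `ρ : D → GL_n(k)` a matrix representation of a group
`D`, `S ⊴ D` a normal subgroup and `x ∈ D`.  Write `V = kⁿ`, `V_S = V ⧸ ⟨ρ(s)v - v⟩` for the
`S`-coinvariants (Mathlib `Representation.Coinvariants`) with the induced action of `x`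
(Mathlib `Representation.toCoinvariants`), and `V_E = Eⁿ` with the base-changed matrix
representation `ρ_E = ρ.map (k → E)`.  Then

`charpoly (x | (V_E)_S) = (charpoly (x | V_S)).map (k → E)`

(`charpoly_toCoinvariants_map`): coinvariants are a cokernel, extension of scalars is right exact
(Mathlib `lTensor_exact`), `E ⊗_k kⁿ = Eⁿ` (Mathlib `TensorProduct.piScalarRight`) and the
characteristic polynomial commutes with base change (Mathlib `LinearMap.charpoly_baseChange`).
This is the (elementary) compatibility of local Euler factors `det(1 - Frob T | V_{I})` of
`ℓ`-adic representations with extension of the coefficient field, used to compare the Euler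
factors of the Tate module `V_ℓ(E)` (over `ℚ_ℓ`) with those of Galois representations of
newforms (over `ℚ̄_ℓ`).

## References

* J.-P. Serre, *Facteurs locaux des fonctions zêta des variétés algébriques*, Séminaire DPP
  1969/70, exp. 19, §2.3 (functoriality of `V ↦ V_I`, independence of the coefficient field).
* Bourbaki, *Algèbre*, Ch. II §5 no. 1 (extension of scalars is right exact), Ch. III §8
  (determinants and base change).

## Mathlib / tree search

`lean search 'Coinvariants.*baseChange|baseChange.*Coinvariants|charpoly_toCoinvariants_map'`: no
hits.  Mathlib: `LinearMap.charpoly_baseChange`, `lTensor_exact`, `TensorProduct.piScalarRight`,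
`Function.Exact.linearEquivOfSurjective`, `Submodule.Quotient.equiv`, `LinearEquiv.charpoly_conj`.
Tree: `FramedRep.baseChangeRepresentation` (`ContinuousRep`), `FramedRep.charpoly_baseChange`
(`FramedRepBaseChange`, the matrices themselves).
-/

noncomputable section

open scoped TensorProduct
open Polynomial Matrix

namespace Literature.NumberTheory.GaloisRepresentations

universe u v w

section BaseChange

variable {k : Type u} [Field k] {E : Type v} [Field E] {D : Type w} [Group D] {n : ℕ}

set_option maxHeartbeats 800000 in
/-- **Coinvariants commute with extension of scalars.**  For a field homomorphism `i : k → E`,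
a matrix representation `ρ : D → GL_n(k)`, a normal subgroup `S ⊴ D` and `x ∈ D`: the
characteristic polynomial of `x` on the `S`-coinvariants of `Eⁿ` (for `ρ.map i`) is the image
under `i` of the characteristic polynomial of `x` on the `S`-coinvariants of `kⁿ`.
Ref: Serre, *Facteurs locaux* (1970), §2.3; Bourbaki, *Algèbre* II §5 no. 1. [folklore] -/
theorem charpoly_toCoinvariants_map (i : k →+* E) (ρ : D →* GL (Fin n) k) (S : Subgroup D)
    [S.Normal] (x : D) :
    (Representation.toCoinvariants ((glStdRepresentation (Fin n) E).comp
        ((Matrix.GeneralLinearGroup.map i).comp ρ)) S x).charpoly =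
      ((Representation.toCoinvariants ((glStdRepresentation (Fin n) k).comp ρ) S x).charpoly).map
        i := by
  classical
  letI : Algebra k E := i.toAlgebra
  have hi : algebraMap k E = i := rfl
  set ρk : Representation k D (Fin n → k) := (glStdRepresentation (Fin n) k).comp ρ with hρk
  set ρE : Representation E D (Fin n → E) :=
    (glStdRepresentation (Fin n) E).comp ((Matrix.GeneralLinearGroup.map i).comp ρ) with hρE
  have hρk_apply : ∀ (d : D) (v : Fin n → k),
      ρk d v = ((ρ d : GL (Fin n) k) : Matrix (Fin n) (Fin n) k) *ᵥ v := fun _ _ => rfl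
  have hρE_apply : ∀ (d : D) (w : Fin n → E),
      ρE d w = (((ρ d : GL (Fin n) k) : Matrix (Fin n) (Fin n) k).map i) *ᵥ w := fun _ _ => rfl
  -- `α : E ⊗ kⁿ ≃ Eⁿ`
  set α : E ⊗[k] (Fin n → k) ≃ₗ[E] (Fin n → E) := TensorProduct.piScalarRight k E E (Fin n)
    with hαdef
  have hα : ∀ (e : E) (v : Fin n → k), α (e ⊗ₜ v) = fun l => v l • e := fun e v => by
    rw [hαdef, TensorProduct.piScalarRight_apply, TensorProduct.piScalarRightHom_tmul]
  -- naturality of `α` for the matrix actions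
  have hnat : ∀ (d : D) (e : E) (v : Fin n → k), α (e ⊗ₜ ρk d v) = ρE d (α (e ⊗ₜ v)) := by
    intro d e v
    rw [hα, hα, hρk_apply, hρE_apply]
    ext l
    simp only [Matrix.mulVec, dotProduct, Matrix.map_apply, Finset.sum_smul]
    refine Finset.sum_congr rfl fun j _ => ?_
    simp only [Algebra.smul_def, hi, map_mul, mul_assoc]
  -- the kernels defining the coinvariants
  set Kk : Submodule k (Fin n → k) := Representation.Coinvariants.ker (ρk.comp S.subtype) with hKk
  set KE : Submodule E (Fin n → E) := Representation.Coinvariants.ker (ρE.comp S.subtype) with hKE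
  -- `j v = α (1 ⊗ v)` : `kⁿ → Eⁿ`
  set j : (Fin n → k) →ₗ[k] (Fin n → E) :=
    (α.restrictScalars k).toLinearMap ∘ₗ TensorProduct.mk k E (Fin n → k) 1 with hjdef
  have hj : ∀ v, j v = α (1 ⊗ₜ v) := fun _ => rfl
  have hjρ : ∀ (s : D) (v : Fin n → k), j (ρk s v) = ρE s (j v) := fun s v => by
    rw [hj, hj, hnat]
  -- `K_E = span_E (j '' K_k)`
  have hgenE : ∀ (s : S) (w : Fin n → E), ρE s w - w ∈ Submodule.span E (j '' (Kk : Set _)) := by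
    intro s w
    obtain ⟨t, rfl⟩ := α.surjective w
    induction t using TensorProduct.induction_on with
    | zero => simp
    | tmul e v =>
      have h1 : α (e ⊗ₜ[k] v) = e • j v := by
        rw [hj, ← map_smul, TensorProduct.smul_tmul', smul_eq_mul, mul_one]
      rw [h1, map_smul, ← smul_sub]
      refine Submodule.smul_mem _ _ (Submodule.subset_span ⟨ρk s v - v, ?_, ?_⟩)
      · exact Representation.Coinvariants.sub_mem_ker (ρ := ρk.comp S.subtype) s v
      · rw [map_sub, hjρ]
    | add t₁ t₂ h₁ h₂ =>
      rw [map_add, map_add]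
      have : ρE s (α t₁) + ρE s (α t₂) - (α t₁ + α t₂) =
          (ρE s (α t₁) - α t₁) + (ρE s (α t₂) - α t₂) := by abel
      rw [this]
      exact Submodule.add_mem _ h₁ h₂
  have hKE_eq : KE = Submodule.span E (j '' (Kk : Set _)) := by
    apply le_antisymm
    · rw [hKE, Representation.Coinvariants.ker, Submodule.span_le]
      rintro _ ⟨⟨s, w⟩, rfl⟩
      exact hgenE s w
    · rw [Submodule.span_le]
      rintro _ ⟨v, hv, rfl⟩
      rw [hKk, Representation.Coinvariants.ker] at hv
      rw [SetLike.mem_coe]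
      refine Submodule.span_induction (p := fun v _ => j v ∈ KE) ?_ ?_ ?_ ?_ hv
      · rintro _ ⟨⟨s, v⟩, rfl⟩
        change j (ρk s v - v) ∈ KE
        rw [map_sub, hjρ]
        exact Representation.Coinvariants.sub_mem_ker (ρ := ρE.comp S.subtype) s (j v)
      · simp
      · intro a b _ _ ha hb
        rw [map_add]
        exact Submodule.add_mem _ ha hb
      · intro c v _ hv
        rw [LinearMap.map_smul_of_tower]
        have : c • j v = (algebraMap k E c) • j v := algebra_compatible_smul E c (j v)
        rw [this]
        exact Submodule.smul_mem _ _ hv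
  -- right exactness of `E ⊗_k -`
  set f : E ⊗[k] Kk →ₗ[E] E ⊗[k] (Fin n → k) := (Kk.subtype).baseChange E with hfdef
  set g : E ⊗[k] (Fin n → k) →ₗ[E] E ⊗[k] Representation.Coinvariants (ρk.comp S.subtype) :=
    (Representation.Coinvariants.mk (ρk.comp S.subtype)).baseChange E with hgdef
  have hex : Function.Exact f g := by
    rw [hfdef, hgdef, LinearMap.baseChange_eq_ltensor, LinearMap.baseChange_eq_ltensor]
    exact lTensor_exact E (LinearMap.exact_subtype_mkQ Kk) (Submodule.mkQ_surjective Kk)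
  have hsurj : Function.Surjective g := by
    rw [hgdef, LinearMap.baseChange_eq_ltensor]
    exact LinearMap.lTensor_surjective E (Representation.Coinvariants.mk_surjective _)
  set Θ₁ := hex.linearEquivOfSurjective hsurj with hΘ₁
  -- `α` carries `range f` onto `K_E`
  have hrange : LinearMap.range f =
      Submodule.span E ((TensorProduct.mk k E (Fin n → k) 1) '' (Kk : Set _)) := by
    apply le_antisymm
    · rintro _ ⟨t, rfl⟩
      induction t using TensorProduct.induction_on with
      | zero => simp
      | tmul e y =>
        rw [hfdef, LinearMap.baseChange_tmul]
        have : e ⊗ₜ[k] (Kk.subtype y) = e • ((TensorProduct.mk k E (Fin n → k) 1) (y : Fin n → k)) := by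
          rw [TensorProduct.mk_apply, TensorProduct.smul_tmul', smul_eq_mul, mul_one]; rfl
        rw [this]
        exact Submodule.smul_mem _ _ (Submodule.subset_span ⟨y, y.2, rfl⟩)
      | add t₁ t₂ h₁ h₂ =>
        rw [map_add]
        exact Submodule.add_mem _ h₁ h₂
    · rw [Submodule.span_le]
      rintro _ ⟨y, hy, rfl⟩
      refine ⟨(1 : E) ⊗ₜ ⟨y, hy⟩, ?_⟩
      rw [hfdef, LinearMap.baseChange_tmul]
      rfl
  have hmap : (LinearMap.range f).map (α : E ⊗[k] (Fin n → k) →ₗ[E] (Fin n → E)) = KE := by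
    rw [hrange, Submodule.map_span, hKE_eq, ← Set.image_comp]
    congr 1
  set Θ₂ := Submodule.Quotient.equiv _ _ α hmap with hΘ₂
  -- the comparison isomorphism `(Eⁿ)_S ≃ E ⊗ (kⁿ)_S`
  let Θ : Representation.Coinvariants (ρE.comp S.subtype) ≃ₗ[E]
      E ⊗[k] Representation.Coinvariants (ρk.comp S.subtype) := Θ₂.symm.trans Θ₁
  have hΘmk : ∀ t : E ⊗[k] (Fin n → k),
      Θ (Representation.Coinvariants.mk (ρE.comp S.subtype) (α t)) = g t := by
    intro t
    change Θ₁ (Θ₂.symm (Submodule.Quotient.mk (α t))) = g t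
    have h2 : Θ₂.symm (Submodule.Quotient.mk (α t)) = Submodule.Quotient.mk t := by
      rw [LinearEquiv.symm_apply_eq, hΘ₂, Submodule.Quotient.equiv_apply, Submodule.mapQ_apply]
      rfl
    rw [h2, hΘ₁, Function.Exact.linearEquivOfSurjective_apply, Submodule.liftQ_apply]
  -- `Θ` intertwines `x | (Eⁿ)_S` with the base change of `x | (kⁿ)_S`
  set TE := ρE.toCoinvariants S x with hTE
  set Tk := ρk.toCoinvariants S x with hTk
  have hsemi : ∀ c, Θ (TE c) = (Tk.baseChange E) (Θ c) := by
    intro c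
    obtain ⟨w, rfl⟩ := Representation.Coinvariants.mk_surjective (ρE.comp S.subtype) c
    obtain ⟨t, rfl⟩ := α.surjective w
    induction t using TensorProduct.induction_on with
    | zero => simp
    | tmul e v =>
      rw [hTE, Representation.toCoinvariants_mk, ← hnat, hΘmk, hΘmk, hgdef,
        LinearMap.baseChange_tmul, LinearMap.baseChange_tmul, LinearMap.baseChange_tmul, hTk,
        Representation.toCoinvariants_mk]
    | add t₁ t₂ h₁ h₂ =>
      rw [map_add, map_add, map_add, map_add, h₁, h₂, map_add, map_add]
  have hconj : Θ.conj TE = Tk.baseChange E := by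
    apply LinearMap.ext
    intro t
    rw [LinearEquiv.conj_apply_apply, hsemi, LinearEquiv.apply_symm_apply]
  rw [← LinearEquiv.charpoly_conj Θ TE, hconj, LinearMap.charpoly_baseChange, hi]

end BaseChange

end Literature.NumberTheory.GaloisRepresentations

end
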